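import Literature.NumberTheory.DiophantineGeometry.BelyiDegreeThreeJZero
import HarnessLib

/-!
# Preliminaries for Belyi degree `4` on elliptic curves: `L(n O)`, vertical tangents, fibres

Topic `NumberTheory/DiophantineGeometry`; sequel to `BelyiDegreeThreeJZero.lean` (`deg_B(E) = 3 ↔
j(E) = 0`) in the orbit of the named fact `javanpeykar2014_stableFaltingsHeight_le`, preparing the
last clause of [cite: Zapponi2009BelyiDegree, Example 1.2] ("There are two isomorphism classes of
elliptic curves with Belyi degree `4`, corresponding to `j = 1728` and `j = 207646/6561`"). For an
elliptic curve `E/K` (`char K = 0`) and its function field `K̄(E)` (`K̄ = AlgebraicClosure K`):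

* **`exists_eq_aeval_add_aeval_mul_genY`** (Silverman, *AEC*, Prop. III.3.1 (proof), `L(n O) =
  ⟨xⁱ, xⁱ y⟩`): a function regular off `O` is `p(x) + q(x) y` with `2 deg p ≤ -ord_O` and
  `2 deg q + 3 ≤ -ord_O` (and `-ord_O = max`);
* **`ordAt_genX_sub_pos_iff`**: `x - e` vanishes at the affine point `(a, b)` iff `a = e`;
  **`ordAt_genX_sub_eq_two_iff`**: `ord_{(e,b)}(x - e) = 2` iff `(e, b)` is its own negative
  (`2b + a₁e + a₃ = 0`, a `2`-torsion point), and then `e` is a root of the `2`-division cubic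
  `4X³ + b₂X² + 2b₄X + b₆` (`two_division_cubic_eq_zero`);
* **`IsBelyiFunction.fibres_of_finrank_eq_four`**: a Belyi function of degree `4` on `K̄(E)` has two
  one-point fibres (multiplicity `4`) and one two-point fibre among its fibres over `0, 1, ∞`
  (Riemann–Hurwitz: `#f⁻¹{0,1,∞} = d + 2 - 2g = 4`).

## References

* L. Zapponi, *On the Belyi degree(s) of a curve defined over a number field*, arXiv:0904.0967
  (2009), Example 1.2. [Zapponi2009BelyiDegree]
* J. H. Silverman, *The Arithmetic of Elliptic Curves*, 2nd ed., GTM 106, Springer 2009,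
  Prop. III.3.1, Group Law Algorithm III.2.3. [SilvermanAEC2009]
-/

noncomputable section

open scoped Classical IntermediateField Polynomial.Bivariate
open Polynomial WeierstrassCurve
open Literature.NumberTheory.EllipticCurves.WeierstrassFunctionField
open Literature.Computability.Cryptography.Csidh

universe u

namespace Literature.NumberTheory.DiophantineGeometry

open AlgFunctionField BelyiDegreeThreeJZero

namespace BelyiDegreeFour

variable {K : Type u} [Field K] {W : WeierstrassCurve K} [W.IsElliptic]

/-! ### `L(n O) = ⟨xⁱ, xⁱ y⟩` -/

/-- **Functions regular off `O` are polynomials in `x, y`**: if `u ≠ 0` has `ord_R u ≥ 0` at every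
affine point then `u = p(x) + q(x) y` with `p, q ∈ K̄[X]`, and `-ord_O u = deg N(p + q y) =
max (2 deg p, 2 deg q + 3)`: precisely `2 deg p ≤ -ord_O u` (if `p ≠ 0`), `2 deg q + 3 ≤ -ord_O u`
(if `q ≠ 0`), and one of them is an equality. This is the basis `{xⁱ} ∪ {xⁱ y}` of `L(n O)`
(Silverman, *AEC*, proof of Prop. III.3.1; the case `n ≤ 3` is `Csidh.exists_eq_lin_of_ordAt`).
[cite: SilvermanAEC2009, Prop. III.3.1 (proof)] -/
theorem exists_eq_aeval_add_aeval_mul_genY {u : W.geomFunctionField} (hu : u ≠ 0)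
    (hreg : ∀ R : W.geomPoints, R ≠ 0 → 0 ≤ W.ordAt R u) :
    ∃ p q : (AlgebraicClosure K)[X],
      u = aeval W.genX p + aeval W.genX q * W.genY ∧
      (p ≠ 0 → 2 * (p.natDegree : ℤ) ≤ -W.ordAt 0 u) ∧
      (q ≠ 0 → 2 * (q.natDegree : ℤ) + 3 ≤ -W.ordAt 0 u) ∧
      (-W.ordAt 0 u = 2 * (p.natDegree : ℤ) ∨
        (q ≠ 0 ∧ -W.ordAt 0 u = 2 * (q.natDegree : ℤ) + 3)) := by
  -- `u` is a regular function
  obtain ⟨w, hw⟩ := exists_algebraMap_eq_of_forall_placeValuation_le_one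
    (V := (W.baseChange (AlgebraicClosure K)).toAffine) (u := u)
    (fun a b hab ↦ (placeValuation_le_one_iff_ord_nonneg _ hu).mpr
      (hreg (.some a b hab) (Affine.Point.some_ne_zero hab)))
  have hw0 : w ≠ 0 := by
    rintro rfl
    exact hu (by rw [← hw, map_zero])
  obtain ⟨p, q, hpq⟩ := Affine.CoordinateRing.exists_smul_basis_eq w
  have hpq0 : p • (1 : (W.baseChange (AlgebraicClosure K)).toAffine.CoordinateRing) +
      q • Affine.CoordinateRing.mk (W.baseChange (AlgebraicClosure K)).toAffine Y ≠ 0 := by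
    rw [hpq]; exact hw0
  -- `-ord_O u = deg N(w) = max (2 deg p, 2 deg q + 3)`
  have hordw : W.ordAt 0 u = -(normDeg (W.baseChange (AlgebraicClosure K)).toAffine w : ℤ) := by
    rw [← hw]
    exact ord_zero_algebraMap hw0
  have hnd : (normDeg (W.baseChange (AlgebraicClosure K)).toAffine w : WithBot ℕ) =
      max (2 • p.degree) (2 • q.degree + 3) := by
    rw [← hpq]
    exact normDeg_smul_basis hpq0
  obtain ⟨dq0, dp0, dpq⟩ := natDegree_data_of_eq_max hnd
  refine ⟨p, q, ?_, fun hp ↦ ?_, fun hq ↦ ?_, ?_⟩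
  · rw [← hw, ← hpq, Affine.CoordinateRing.smul, Affine.CoordinateRing.smul, mul_one, ← map_mul,
      ← map_add, EllipticCurves.WeierstrassFunctionField.algebraMap_mk, map_add, map_mul,
      aevalAeval_C, aevalAeval_C, aevalAeval_Y]
  · rw [hordw, neg_neg]
    by_cases hq : q = 0
    · obtain ⟨-, hn⟩ := dq0 hq
      rw [hn]; push_cast; omega
    · have hn := dpq hq hp
      rw [hn]; push_cast; omega
  · rw [hordw, neg_neg]
    by_cases hp : p = 0
    · have hn := dp0 hq hp
      rw [hn]; push_cast; omega
    · have hn := dpq hq hp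
      rw [hn]; push_cast; omega
  · rw [hordw, neg_neg]
    by_cases hq : q = 0
    · obtain ⟨-, hn⟩ := dq0 hq
      left; rw [hn]; push_cast; ring
    · by_cases hp : p = 0
      · right; exact ⟨hq, by rw [dp0 hq hp]; push_cast; ring⟩
      · rw [dpq hq hp]
        rcases le_total (2 * p.natDegree) (2 * q.natDegree + 3) with h | h
        · right; exact ⟨hq, by rw [max_eq_right h]; push_cast; ring⟩
        · left; rw [max_eq_left h]; push_cast; ring

/-- **`L(4 O) = ⟨1, x, y, x²⟩`**: a function regular off `O` with `ord_O u = -4` is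
`u = a + b x + c y + d x²` with `d ≠ 0`. [cite: SilvermanAEC2009, Prop. III.3.1 (proof)] -/
theorem exists_eq_quad_of_ordAt_eq_neg_four {u : W.geomFunctionField} (hu : u ≠ 0)
    (hreg : ∀ R : W.geomPoints, R ≠ 0 → 0 ≤ W.ordAt R u) (h4 : W.ordAt 0 u = -4) :
    ∃ a b c d : AlgebraicClosure K, d ≠ 0 ∧
      u = algebraMap _ W.geomFunctionField a + algebraMap _ W.geomFunctionField b * W.genX +
        algebraMap _ W.geomFunctionField c * W.genY +
        algebraMap _ W.geomFunctionField d * W.genX ^ 2 := by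
  obtain ⟨p, q, hupq, hp, hq, hmax⟩ := exists_eq_aeval_add_aeval_mul_genY hu hreg
  rw [h4] at hp hq hmax
  norm_num at hp hq hmax
  -- `deg p = 2`, `deg q ≤ 0`
  have hqdeg : q.natDegree = 0 := by
    by_cases hq0 : q = 0
    · rw [hq0, natDegree_zero]
    · have := hq hq0; omega
  have hpdeg : p.natDegree = 2 := by
    rcases hmax with h | ⟨hq0, h⟩
    · omega
    · have := hq hq0; omega
  have hp2 : p = C (p.coeff 2) * X ^ 2 + C (p.coeff 1) * X + C (p.coeff 0) := by
    conv_lhs => rw [p.as_sum_range_C_mul_X_pow, hpdeg]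
    simp [Finset.sum_range_succ]
    ring
  have hq0' : q = C (q.coeff 0) := eq_C_of_natDegree_eq_zero hqdeg
  refine ⟨p.coeff 0, p.coeff 1, q.coeff 0, p.coeff 2, ?_, ?_⟩
  · have hlc : p.leadingCoeff ≠ 0 := by
      rw [Ne, leadingCoeff_eq_zero]
      rintro rfl
      rw [natDegree_zero] at hpdeg
      exact absurd hpdeg (by norm_num)
    rwa [leadingCoeff, hpdeg] at hlc
  · rw [hupq]
    conv_lhs => rw [hp2, hq0']
    simp only [map_add, map_mul, map_pow, aeval_C, aeval_X]
    ring

/-! ### Zeros of `x - e`: the points over `e`; vertical tangents -/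

/-- **`x - e` vanishes at the affine point `(a, b)` iff `a = e`.** [folklore] -/
theorem ordAt_genX_sub_pos_iff {a b : AlgebraicClosure K}
    (h : (W.baseChange (AlgebraicClosure K)).toAffine.Nonsingular a b) (e : AlgebraicClosure K) :
    0 < W.ordAt (.some a b h) (W.genX - algebraMap _ W.geomFunctionField e) ↔ a = e := by
  refine ⟨fun hpos ↦ ?_, fun hae ↦ hae ▸ ordAt_genX_sub_pos h⟩
  have hx : ∀ c : AlgebraicClosure K, W.genX - algebraMap _ W.geomFunctionField c ≠ 0 :=
    fun c h0 ↦ transcendental_genX W ((sub_eq_zero.1 h0) ▸ isAlgebraic_algebraMap c)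
  have hva :
      (W.place (.some a b h)).valuation (W.genX - algebraMap _ W.geomFunctionField a) < 1 := by
    rw [PlaceOver.valuation_lt_one_iff_ord_pos _ (hx a), ← ordAt_eq_ord_place _ (hx a)]
    exact ordAt_genX_sub_pos h
  have hve :
      (W.place (.some a b h)).valuation (W.genX - algebraMap _ W.geomFunctionField e) < 1 := by
    rw [PlaceOver.valuation_lt_one_iff_ord_pos _ (hx e), ← ordAt_eq_ord_place _ (hx e)]
    exact hpos
  exact WeierstrassBelyi.ne_of_valuation_x_sub_lt (W.baseChange (AlgebraicClosure K)).toAffine hva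
    hve

/-- If `x - e` has a simple zero at `P = (e, b)` then it has another zero `R ≠ P` (the zeros of
`x - e` have total multiplicity `[K̄(E) : K̄(x)] = 2`). [cite: SilvermanAEC2009, Prop. II.2.6(a)] -/
theorem exists_ne_of_ordAt_genX_sub_eq_one {e b : AlgebraicClosure K}
    (h : (W.baseChange (AlgebraicClosure K)).toAffine.Nonsingular e b)
    (h1 : W.ordAt (.some e b h) (W.genX - algebraMap _ W.geomFunctionField e) = 1) :
    ∃ R : W.geomPoints, R ≠ .some e b h ∧
      0 < W.ordAt R (W.genX - algebraMap _ W.geomFunctionField e) := by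
  classical
  haveI := isIntegrallyClosedIn_of_isAlgClosed (K := AlgebraicClosure K) (F := W.geomFunctionField)
  have hrat : ∀ P : PlaceOver (AlgebraicClosure K) W.geomFunctionField, P.IsRational :=
    PlaceOver.isRational_of_isAlgClosed
  have hxK : W.genX ∉ Set.range (algebraMap (AlgebraicClosure K) W.geomFunctionField) := by
    rintro ⟨c, hc⟩
    exact transcendental_genX W (hc ▸ isAlgebraic_algebraMap c)
  have hx0 : W.genX - algebraMap (AlgebraicClosure K) W.geomFunctionField e ≠ 0 := fun h0 ↦
    hxK ⟨e, (sub_eq_zero.1 h0).symm⟩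
  set U : Finset (PlaceOver (AlgebraicClosure K) W.geomFunctionField) :=
    (finite_setOf_ord_ne_zero_holds (K := AlgebraicClosure K) hx0).toFinset.filter
      fun Q ↦ 0 < Q.ord (W.genX - algebraMap _ W.geomFunctionField e) with hU
  have hmem : ∀ Q, Q ∈ U ↔ 0 < Q.ord (W.genX - algebraMap _ W.geomFunctionField e) := fun Q ↦ by
    rw [hU, Finset.mem_filter, Set.Finite.mem_toFinset, Set.mem_setOf_eq]
    exact ⟨fun h ↦ h.2, fun h ↦ ⟨h.ne', h⟩⟩
  have hsum := sum_ord_sub_eq_finrank hrat hxK e U (fun Q hQ ↦ (hmem Q).1 hQ)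
    fun Q hQ ↦ (hmem Q).2 hQ
  have hfin : Module.finrank (AlgebraicClosure K)⟮W.genX⟯ W.geomFunctionField = 2 :=
    WeierstrassBelyi.finrank_adjoin_x (W.baseChange (AlgebraicClosure K)).toAffine
  rw [hfin] at hsum
  set P : W.geomPoints := .some e b h with hPdef
  have hPU : W.place P ∈ U := (hmem _).2 (by rw [← ordAt_eq_ord_place P hx0, h1]; exact one_pos)
  have hsplit := Finset.sum_erase_add U
    (fun Q ↦ Q.ord (W.genX - algebraMap _ W.geomFunctionField e)) hPU
  rw [hsum, ← ordAt_eq_ord_place P hx0, h1] at hsplit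
  -- the remaining zeros have total multiplicity `1 > 0`: there is one
  have hne : (U.erase (W.place P)).Nonempty := by
    by_contra hemp
    rw [Finset.not_nonempty_iff_eq_empty] at hemp
    rw [hemp, Finset.sum_empty] at hsplit
    norm_num at hsplit
  obtain ⟨Q, hQ⟩ := hne
  obtain ⟨R, rfl⟩ := place_surjective (W := W) Q
  refine ⟨R, fun hRP ↦ (Finset.mem_erase.1 hQ).1 (by rw [hRP]), ?_⟩
  rw [ordAt_eq_ord_place R hx0]
  exact (hmem _).1 (Finset.mem_of_mem_erase hQ)

/-- **Vertical tangents: `ord_{(e,b)}(x - e) = 2` iff `(e, b)` is its own negative**, i.e.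
`2b + a₁e + a₃ = 0` (a point of order `2`). Otherwise `x - e` has the two simple zeros `(e, b)` and
`-(e, b)`. [cite: SilvermanAEC2009, Group Law Algorithm III.2.3] -/
theorem ordAt_genX_sub_eq_two_iff {e b : AlgebraicClosure K}
    (h : (W.baseChange (AlgebraicClosure K)).toAffine.Nonsingular e b) :
    W.ordAt (.some e b h) (W.genX - algebraMap _ W.geomFunctionField e) = 2 ↔
      (W.baseChange (AlgebraicClosure K)).toAffine.negY e b = b := by
  have hneg : (W.baseChange (AlgebraicClosure K)).toAffine.Nonsingular e
      ((W.baseChange (AlgebraicClosure K)).toAffine.negY e b) := (Affine.nonsingular_neg e b).2 h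
  constructor
  · intro h2
    rcases ordAt_genX_sub_cases (W := W) h with h1 | ⟨-, hR⟩
    · omega
    · -- the conjugate point is also a zero of `x - e`, hence equals `(e, b)`
      by_contra hne
      have hne' : (Affine.Point.some _ _ hneg : W.geomPoints) ≠ .some e b h := by
        intro heq
        rw [Affine.Point.some.injEq] at heq
        exact hne heq.2
      have h0 := hR _ (Affine.Point.some_ne_zero hneg) hne'
      have hpos := ordAt_genX_sub_pos (W := W) hneg
      omega
  · intro hnb
    rcases ordAt_genX_sub_cases (W := W) h with h1 | ⟨h2, -⟩
    · -- a second zero would be a second point over `e`: impossible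
      exfalso
      obtain ⟨R, hRP, hR⟩ := exists_ne_of_ordAt_genX_sub_eq_one h h1
      have hR0 : R ≠ 0 := by
        rintro rfl
        have := ordAt_zero_genX_sub (W := W) e
        omega
      obtain ⟨a, b', h', rfl⟩ := geomPoints.exists_eq_some hR0
      have hae : a = e := (ordAt_genX_sub_pos_iff h' e).1 hR
      subst hae
      have hb' : b' = b := by
        rcases Affine.Y_eq_of_X_eq h'.1 h.1 rfl with hb | hb
        · exact hb
        · rw [hb, hnb]
      subst hb'
      exact hRP rfl
    · exact h2

/-- **The `2`-division cubic**: a point `(e, b)` of `E` which is its own negative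
(`2b + a₁e + a₃ = 0`) has `4e³ + b₂e² + 2b₄e + b₆ = 0`. [cite: SilvermanAEC2009, Group Law
Algorithm III.2.3] -/
theorem two_division_cubic_eq_zero {k : Type*} [CommRing k] (V : WeierstrassCurve k) {e b : k}
    (heq : V.toAffine.Equation e b) (hneg : V.toAffine.negY e b = b) :
    4 * e ^ 3 + V.b₂ * e ^ 2 + 2 * V.b₄ * e + V.b₆ = 0 := by
  rw [Affine.equation_iff] at heq
  rw [Affine.negY] at hneg
  rw [WeierstrassCurve.b₂, WeierstrassCurve.b₄, WeierstrassCurve.b₆]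
  linear_combination (-4 : k) * heq + (-(V.a₁ * e) - V.a₃ - 2 * b) * hneg

/-! ### Fibres of a degree-`4` Belyi function in genus one -/

/-- **The special fibres of a degree-`4` Belyi function on `K̄(E)`**: the fibres over `0, 1, ∞`
contain `4 = d + 2 - 2g` places in total (Riemann–Hurwitz, `card_add_card_add_card_eq`), each is
non-empty, and the multiplicities in each fibre sum to `4`; hence two of them are single places of
multiplicity `4` and one consists of two places. [cite: Zapponi2009BelyiDegree, Example 1.2] -/
theorem fibres_of_finrank_eq_four {K' : Type u} {F : Type u} [Field K'] [Field F] [Algebra K' F]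
    [IsAlgFunctionField K' F] [IsAlgClosed K'] [CharZero K'] {f : F} (hf : IsBelyiFunction K' f)
    (hg : genus K' F = 1) (hd : Module.finrank K'⟮f⟯ F = 4) (U₀ U₁ Ui : Finset (PlaceOver K' F))
    (hU₀ : ∀ P, P ∈ U₀ ↔ 0 < P.ord f) (hU₁ : ∀ P, P ∈ U₁ ↔ 0 < P.ord (f - 1))
    (hUi : ∀ P, P ∈ Ui ↔ P.ord f < 0) :
    U₀.card + U₁.card + Ui.card = 4 ∧
      (∑ P ∈ U₀, P.ord f = 4 ∧ ∑ P ∈ U₁, P.ord (f - 1) = 4 ∧ ∑ P ∈ Ui, -P.ord f = 4) ∧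
      0 < U₀.card ∧ 0 < U₁.card ∧ 0 < Ui.card := by
  classical
  haveI := isIntegrallyClosedIn_of_isAlgClosed (K := K') (F := F)
  have hrat : ∀ P : PlaceOver K' F, P.IsRational := PlaceOver.isRational_of_isAlgClosed
  have hy := hf.not_mem_range
  have hcard := hf.card_add_card_add_card_eq_of_isAlgClosed U₀ U₁ Ui hU₀ hU₁ hUi
  rw [hd, hg] at hcard
  norm_num at hcard
  have hcard' : U₀.card + U₁.card + Ui.card = 4 := by omega
  have s0 := sum_ord_sub_eq_finrank hrat hy 0 U₀ (fun P hP ↦ by simpa using (hU₀ P).1 hP)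
    (fun P hP ↦ (hU₀ P).2 (by simpa using hP))
  have s1 := sum_ord_sub_eq_finrank hrat hy 1 U₁ (fun P hP ↦ by simpa using (hU₁ P).1 hP)
    (fun P hP ↦ (hU₁ P).2 (by simpa using hP))
  have si := sum_neg_ord_eq_finrank hrat hy Ui (fun P hP ↦ (hUi P).1 hP) (fun P hP ↦ (hUi P).2 hP)
  simp only [map_zero, sub_zero, map_one, hd, Nat.cast_ofNat] at s0 s1 si
  have hpos : ∀ (U : Finset (PlaceOver K' F)) (g : PlaceOver K' F → ℤ), (∀ P ∈ U, 0 < g P) →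
      ∑ P ∈ U, g P = 4 → 0 < U.card := by
    intro U g _ hs
    rw [Finset.card_pos]
    by_contra hemp
    rw [Finset.not_nonempty_iff_eq_empty] at hemp
    rw [hemp, Finset.sum_empty] at hs
    norm_num at hs
  refine ⟨hcard', ⟨s0, s1, si⟩, hpos U₀ _ (fun P hP ↦ (hU₀ P).1 hP) s0,
    hpos U₁ _ (fun P hP ↦ (hU₁ P).1 hP) s1, hpos Ui (fun P ↦ -P.ord f) (fun P hP ↦ ?_) si⟩
  have := (hUi P).1 hP
  omega

end BelyiDegreeFour

end Literature.NumberTheory.DiophantineGeometry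

end
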